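import Literature.Computability.Complexity.StackModArith
import HarnessLib

/-!
# Verified arithmetic on stack programs, II: multiplication, division with remainder, and a
calculator bank for modular products and powers

Trunk `CplxCore`, toolkit for `TimeBounds.lean`, continuing `StackArith.lean` (and importing
`StackModArith.lean`, see below). The register type is `MReg = AReg ⊕ MOwn`: the arithmetic
bank of `StackArith.lean` (used through `Com.map Sum.inl`) plus four registers `p q r w`, and,
one level up, `EReg = MReg ⊕ EOwn` with four more registers `b e a m`.

The two routines of this file and their siblings (the `Stack*.lean` directory as it stands —
`StackArith`, `StackModArith`, `StackGcd`, `StackDiv`, `StackMul`):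

* `mul` — the general product `r := p · q` by shift-and-add over the multiplier bits *least
  significant first* (`runs_mul`, `bitsToNat_mulRes`, quadratic cost), on the fixed bank
  `MReg`, operands read from bank registers and not consumed (`q`), result unnormalised. The
  same product exists as `StackMul.Com.mulOf m` (`runs_mulOf`, `bitsToNat_mulOfRes`): Horner,
  multiplier consumed from an *outer* register most significant bit first, result normalised.
* `divMod` — quotient AND remainder `r := p / q`, `w := p % q` by restoring long division,
  most significant dividend bit first (`runs_divMod`, `bitsToNat_divMod`, quadratic cost). The
  same long division exists in two sibling files: `StackGcd.Com.remStep b`/`remOf m`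
  (remainder only; the step of our model `dmL`, `bif subBorrow (b :: x) ys then b :: x else
  subRes (b :: x) ys`, is literally `StackGcd.remStepRaw b x ys`) and `StackDiv.Com.divOf m q`
  (quotient bit pushed per step onto an outer register, `divBits`, `divOf_spec`,
  `divOf_div_mod`). What remains different here: the fixed bank `MReg` (dividend from the bank
  register `p`, reversed in place), quotient and remainder both left in bank registers (`r`,
  `w`), no per-step normalisation (the callers `StackNumeric.nDivMod`/`mulMod` normalise once).

These second renderings are kept for one concrete reason, the same as for the modular routines
below: the numeric procedure layer `StackNumeric.lean` (twenty procedures `base T ↦ base T'`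
over `EReg ⊕ β`, operands named in the outer bank and never consumed) and everything above it
(`StackScript.lean`, `StackOracle.lean`, the Blum–Micali machine) are stated against the exact
final register files and cost polynomials of `runs_mul`/`runs_divMod`/`runs_powMod`; re-basing
on `mulOf`/`divOf` (which consume their operand from an outer register and were written in
parallel with this file) needs per-routine transport along a register injection, operand
staging and cost reshaping, i.e. this section again, with no gain for the one client.

On top of these, the fixed-bank modular routines of the numeric procedure layer:

* `mulMod dst src` — `dst := dst · src mod m` as "multiply, then `divMod`" (so an unreduced
  operand is allowed and the same division routine serves `mod (p - 1)`, `mod h`, `/ 2`);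
* `powMod` — `a := b ^ e mod m` (square and multiply over the exponent bits, least significant
  bit first, i.e. in the order of `encodeNat`), `runs_powMod`, cubic cost.

**Relation to `StackModArith.lean`.** Modular multiplication and exponentiation with polynomial
`Runs` bounds already exist there (`Com.modMul`, `Com.modExp`, over any register file
`κ ⊕ AReg`, multiplier/exponent read destructively from outer registers `κ`, modulus in
`AReg.y`, by double-and-add without a general multiplication); **that is the canonical modular
exponentiation for new users.** The two routines above are kept as a second rendering for one
concrete reason: the procedure layer `StackNumeric.lean`/`StackScript.lean` (serving the
Blum–Micali machine, `BlumMicaliMachine*.lean`) is built over the fixed calculator type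
`EReg ⊕ β` whose three banks are clean between procedures (`Com.base`), with operands copied
in and normalised results moved out, and it needs the general `mul` and `divMod` anyway;
re-basing its two modular procedures on `StackModArith.modExp` would need the same amount of
glue (transport along an injection `κ ⊕ AReg ↪ EReg ⊕ β`, operand staging, exponent reversal,
cost reshaping) as the c. 300 lines of this file's last section. `length_encodeNat_mod_le` is
derived from `StackModArith.length_norm_le_of_lt`.

## References

* D. E. Knuth, *The Art of Computer Programming*, Vol. 2, 3rd ed., 1998, §4.3.1, Algorithms M
  and D (in the binary, one-bit-quotient-digit form: restoring division), §4.6.3 (binary method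
  for exponentiation). (Not held; schoolbook algorithms, fully proved here.)
* T. H. Cormen, C. E. Leiserson, R. L. Rivest, C. Stein, *Introduction to Algorithms*, 3rd ed.
  2009, §31.6 (MODULAR-EXPONENTIATION; the variant of `StackModArith.lean`).
-/

namespace Literature.Computability.Complexity

open _root_.Computability

/-! ### The registers of the multiplication layer -/

/-- The four registers of the multiplication/division layer: operands `p q`, quotient/product
`r`, remainder `w`. [folklore] -/
inductive MOwn where
  | p | q | r | w
  deriving DecidableEq, Fintype, Repr

namespace MOwn

/-- A register file of the layer given register by register. [folklore] -/
def file (p q r w : List Bool) : Regs MOwn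
  | .p => p | .q => q | .r => r | .w => w

section FileLemmas
variable (p q r w v : List Bool)
/-- Reading `p`. [folklore] -/ @[simp] theorem file_p : file p q r w .p = p := rfl
/-- Reading `q`. [folklore] -/ @[simp] theorem file_q : file p q r w .q = q := rfl
/-- Reading `r`. [folklore] -/ @[simp] theorem file_r : file p q r w .r = r := rfl
/-- Reading `w`. [folklore] -/ @[simp] theorem file_w : file p q r w .w = w := rfl
/-- Writing `p`. [folklore] -/
@[simp] theorem update_file_p : Function.update (file p q r w) .p v = file v q r w := by
  funext i; cases i <;> rfl
/-- Writing `q`. [folklore] -/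
@[simp] theorem update_file_q : Function.update (file p q r w) .q v = file p v r w := by
  funext i; cases i <;> rfl
/-- Writing `r`. [folklore] -/
@[simp] theorem update_file_r : Function.update (file p q r w) .r v = file p q v w := by
  funext i; cases i <;> rfl
/-- Writing `w`. [folklore] -/
@[simp] theorem update_file_w : Function.update (file p q r w) .w v = file p q r v := by
  funext i; cases i <;> rfl
end FileLemmas

end MOwn

/-- Registers of the multiplication layer: the arithmetic bank and `MOwn`. [folklore] -/
abbrev MReg : Type := AReg ⊕ MOwn

namespace Com



/-! ### Multiplication -/

/-- The multiplication loop: over the bits of `p`, add the shifted `q` (kept in `y`) into `x`.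
[Knuth 1998, §4.3.1, Algorithm M (binary)] [folklore] -/
def mulLoop : Com MReg :=
  loop (.inr .p) (add.map Sum.inl ;; push (.inl .y) false) (push (.inl .y) false)

/-- **Multiplication** `r := p · q` (`p`, `q` consumed; the arithmetic bank must be clean and is
left clean). [Knuth 1998, §4.3.1, Algorithm M] [folklore] -/
def mul : Com MReg :=
  move (.inr .q) (.inl .y) (.inl .s) ;; mulLoop ;; move (.inl .x) (.inr .r) (.inl .s) ;; clear (.inl .y)

/-- Model of the multiplication loop: final accumulator and shifted multiplicand. [folklore] -/
def mulL : List Bool → List Bool → List Bool → List Bool × List Bool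
  | [], x, y => (x, y)
  | b :: ps, x, y => mulL ps (bif b then addRes x y else x) (false :: y)

/-- **The product** as computed by `mul`. [folklore] -/
def mulRes (ps qs : List Bool) : List Bool := (mulL ps [] qs).1

/-- Value of the multiplication loop. [Knuth 1998, §4.3.1, Algorithm M] [folklore] -/
theorem bitsToNat_mulL (ps x y : List Bool) : bitsToNat (mulL ps x y).1 = bitsToNat x + bitsToNat ps * bitsToNat y := by
  induction ps generalizing x y with
  | nil => simp [mulL]
  | cons b ps ih => cases b <;> simp [mulL, ih, bitsToNat_addRes] <;> ring

/-- **`mul` is correct.** [Knuth 1998, §4.3.1, Algorithm M] [folklore] -/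
theorem bitsToNat_mulRes (ps qs : List Bool) : bitsToNat (mulRes ps qs) = bitsToNat ps * bitsToNat qs := by
  simp [mulRes, bitsToNat_mulL]

/-- The shifted multiplicand. [folklore] -/
theorem mulL_snd (ps x y : List Bool) : (mulL ps x y).2 = List.replicate ps.length false ++ y := by
  induction ps generalizing x y with
  | nil => simp [mulL]
  | cons b ps ih => simp [mulL, ih, List.replicate_succ']

/-- Length of the accumulator. [folklore] -/
theorem length_mulL_le (ps x y : List Bool) (n : ℕ) (hx : x.length ≤ n + 1) (hy : y.length ≤ n) :
    (mulL ps x y).1.length ≤ n + ps.length + 1 := by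
  induction ps generalizing x y n with
  | nil => simpa [mulL] using hx
  | cons b ps ih =>
    rw [mulL]
    have := ih (bif b then addRes x y else x) (false :: y) (n + 1) ?_ (by simp; omega)
    · simp at this ⊢; omega
    · cases b
      · simp; omega
      · have := length_addRes_le_max x y
        simp; omega

/-- The product has at most `|p| + |q| + 1` bits. [folklore] -/
theorem length_mulRes_le (ps qs : List Bool) : (mulRes ps qs).length ≤ ps.length + qs.length + 1 := by
  have := length_mulL_le ps [] qs qs.length (by simp) le_rfl
  simp [mulRes] at this ⊢; omega

/-- Simulation of the multiplication loop (all lengths bounded by `n` at the start).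
[folklore] -/
theorem runs_mulLoop (ps x y : List Bool) (n : ℕ) (hx : x.length ≤ n + 1) (hy : y.length ≤ n)
    (z u g : List Bool) (q r w : List Bool) :
    Runs mulLoop (Sum.elim (AReg.file x y z [] [] u [] g) (MOwn.file ps q r w))
      (Sum.elim (AReg.file (mulL ps x y).1 (mulL ps x y).2 z [] [] u [] g) (MOwn.file [] q r w))
      (ps.length * (26 * (n + ps.length) + 43) + 1) := by
  induction ps generalizing x y n with
  | nil => exact (Runs.loop_nil _ _ (by rfl)).of_eq (by simp [mulL]) (by simp)
  | cons b ps ih =>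
    have hpush : ∀ x' : List Bool, Runs (push (Sum.inl AReg.y) false)
        (Sum.elim (AReg.file x' y z [] [] u [] g) (MOwn.file ps q r w))
        (Sum.elim (AReg.file x' (false :: y) z [] [] u [] g) (MOwn.file ps q r w)) 1 := fun x' =>
      Runs.push' (by simp)
    cases b
    · have hrest := ih x (false :: y) (n + 1) (by omega) (by simp; omega)
      refine (Runs.loop_false' (w := ps) ?_ ?_ (hpush x) hrest).of_eq ?_ ?_
      · rfl
      · simp
      · simp [mulL]
      · simp; nlinarith
    · have hadd := (runs_add x y z u g).inl (MOwn.file ps q r w)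
      have hbody := hadd.seq (hpush (addRes x y))
      have hlen := length_addRes_le_max x y
      have hrest := ih (addRes x y) (false :: y) (n + 1) (by omega) (by simp; omega)
      refine (Runs.loop_true' (w := ps) ?_ ?_ hbody hrest).of_eq ?_ ?_
      · rfl
      · simp
      · simp [mulL]
      · simp; nlinarith

/-- **Simulation of `mul`**: `r := p · q`, in at most `50 (|p| + |q| + 1)²` steps.
[Knuth 1998, §4.3.1, Algorithm M] [folklore] -/
theorem runs_mul (ps qs z u g w : List Bool) :
    Runs mul (Sum.elim (AReg.file [] [] z [] [] u [] g) (MOwn.file ps qs [] w))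
      (Sum.elim (AReg.file [] [] z [] [] u [] g) (MOwn.file [] [] (mulRes ps qs) w))
      (50 * (ps.length + qs.length + 1) ^ 2) := by
  have h1 : Runs (move (Sum.inr MOwn.q) (Sum.inl AReg.y) (Sum.inl AReg.s))
      (Sum.elim (AReg.file [] [] z [] [] u [] g) (MOwn.file ps qs [] w))
      (Sum.elim (AReg.file [] qs z [] [] u [] g) (MOwn.file ps [] [] w)) (6 * qs.length + 2) :=
    (runs_move (a := (Sum.inr MOwn.q : MReg)) (b := Sum.inl AReg.y) (t := Sum.inl AReg.s)
      (by decide) (by decide) (by decide) _ rfl).of_eq (by ext i; cases i <;> simp) (by simp)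
  have h2 := runs_mulLoop ps [] qs qs.length (by simp) le_rfl z u g [] [] w
  set res := mulL ps [] qs with hres
  have h3 : Runs (move (Sum.inl AReg.x) (Sum.inr MOwn.r) (Sum.inl AReg.s))
      (Sum.elim (AReg.file res.1 res.2 z [] [] u [] g) (MOwn.file [] [] [] w))
      (Sum.elim (AReg.file [] res.2 z [] [] u [] g) (MOwn.file [] [] res.1 w)) (6 * res.1.length + 2) :=
    (runs_move (a := (Sum.inl AReg.x : MReg)) (b := Sum.inr MOwn.r) (t := Sum.inl AReg.s)
      (by decide) (by decide) (by decide) _ rfl).of_eq (by ext i; cases i <;> simp) (by simp)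
  have h4 : Runs (clear (Sum.inl AReg.y))
      (Sum.elim (AReg.file [] res.2 z [] [] u [] g) (MOwn.file [] [] res.1 w))
      (Sum.elim (AReg.file [] [] z [] [] u [] g) (MOwn.file [] [] res.1 w)) (2 * res.2.length + 1) :=
    (runs_clear (Sum.inl AReg.y : MReg) _).of_eq (by ext i; cases i <;> simp) (by simp)
  have hl1 : res.1.length ≤ qs.length + ps.length + 1 := length_mulL_le ps [] qs qs.length (by simp) le_rfl
  have hl2 : res.2.length = ps.length + qs.length := by simp [hres, mulL_snd]
  refine (h1.seq (h2.seq (h3.seq h4))).of_eq (by simp [mulRes, hres]) ?_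
  rw [hl2]
  nlinarith [hl1]

/-! ### Division with remainder -/

/-- After the trial subtraction: record the quotient bit (the comparison flag `g`).
[Knuth 1998, §4.3.1, Algorithm D (binary, restoring)] [folklore] -/
def dmBranch : Com MReg :=
  sub.map Sum.inl ;; pop (.inl .g) (push (.inr .r) true) (push (.inr .r) true) (push (.inr .r) false)

/-- The division loop: bring down the next dividend bit (most significant first, from `z`),
subtract the divisor if possible. [Knuth 1998, §4.3.1, Algorithm D] [folklore] -/
def dmLoop : Com MReg :=
  loop (.inl .z) (push (.inl .x) true ;; dmBranch) (push (.inl .x) false ;; dmBranch)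

/-- **Division with remainder** `r := p / q`, `w := p % q` (`p` consumed, `q` preserved; needs
`q ≠ 0` for the values, `r`, `w` and the arithmetic bank empty). [Knuth 1998, §4.3.1,
Algorithm D] [folklore] -/
def divMod : Com MReg :=
  pour (.inr .p) (.inl .z) ;; move (.inr .q) (.inl .y) (.inl .s) ;; dmLoop ;;
    move (.inl .x) (.inr .w) (.inl .s) ;; move (.inl .y) (.inr .q) (.inl .s)

/-- Model of the division loop (divisor `ys`; dividend bits most significant first; current
remainder; quotient bits so far). [folklore] -/
def dmL (ys : List Bool) : List Bool → List Bool → List Bool → List Bool × List Bool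
  | [], x, r => (x, r)
  | b :: bs, x, r =>
    dmL ys bs (bif subBorrow (b :: x) ys then b :: x else subRes (b :: x) ys)
      ((!subBorrow (b :: x) ys) :: r)

/-- The quotient bits computed by `divMod`. [folklore] -/
def divQ (ps qs : List Bool) : List Bool := (dmL qs ps.reverse [] []).2

/-- The remainder bits computed by `divMod`. [folklore] -/
def divR (ps qs : List Bool) : List Bool := (dmL qs ps.reverse [] []).1

/-- Lengths in the division loop: one remainder bit and one quotient bit per dividend bit.
[folklore] -/
theorem length_dmL (ys bs x r : List Bool) :
    (dmL ys bs x r).1.length = x.length + bs.length ∧ (dmL ys bs x r).2.length = r.length + bs.length := by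
  induction bs generalizing x r with
  | nil => simp [dmL]
  | cons b bs ih =>
    rw [dmL]
    have := ih (bif subBorrow (b :: x) ys then b :: x else subRes (b :: x) ys) ((!subBorrow (b :: x) ys) :: r)
    cases hc : subBorrow (b :: x) ys <;> simp [hc, length_subRes] at this ⊢ <;> omega

/-- **Invariant of restoring division**: `y · quotient + remainder` is the dividend read so
far, and the remainder stays below the divisor. [Knuth 1998, §4.3.1, Algorithm D
(correctness)] [folklore] -/
theorem dmL_val (ys bs x r : List Bool) (hx : bitsToNat x < bitsToNat ys) :
    bitsToNat ys * bitsToNat (dmL ys bs x r).2 + bitsToNat (dmL ys bs x r).1 =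
        (bitsToNat ys * bitsToNat r + bitsToNat x) * 2 ^ bs.length + bitsToNat bs.reverse ∧
      bitsToNat (dmL ys bs x r).1 < bitsToNat ys := by
  induction bs generalizing x r with
  | nil => simpa [dmL] using hx
  | cons b bs ih =>
    rw [dmL]
    have hb := subBorrow_iff (b :: x) ys
    cases hc : subBorrow (b :: x) ys
    · -- no borrow: subtract
      rw [hc] at hb
      have hge : bitsToNat ys ≤ bitsToNat (b :: x) := by simpa using hb
      have hsub := bitsToNat_subRes (b :: x) ys hge
      have hx' : bitsToNat (subRes (b :: x) ys) < bitsToNat ys := by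
        rw [hsub]; simp at hge ⊢; cases b <;> simp <;> omega
      obtain ⟨h1, h2⟩ := ih (subRes (b :: x) ys) (true :: r) hx'
      refine ⟨?_, by simpa using h2⟩
      simp only [cond_false, Bool.not_false] at h1 ⊢
      rw [h1, hsub]
      simp only [bitsToNat_cons, Bool.toNat_true, List.reverse_cons, bitsToNat_append, List.length_reverse,
        List.length_cons, pow_succ, bitsToNat_nil]
      simp only [bitsToNat_cons] at hge
      zify [hge]
      ring
    · rw [hc] at hb
      have hlt : bitsToNat (b :: x) < bitsToNat ys := by simpa using hb
      obtain ⟨h1, h2⟩ := ih (b :: x) (false :: r) hlt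
      refine ⟨?_, by simpa using h2⟩
      simp only [cond_true, Bool.not_true] at h1 ⊢
      rw [h1]
      simp only [bitsToNat_cons, Bool.toNat_false, List.reverse_cons, bitsToNat_append, List.length_reverse,
        List.length_cons, pow_succ, bitsToNat_nil]
      ring

/-- **`divMod` is correct**: quotient and remainder. [Knuth 1998, §4.3.1, Algorithm D]
[folklore] -/
theorem bitsToNat_divMod (ps qs : List Bool) (hq : 0 < bitsToNat qs) :
    bitsToNat (divQ ps qs) = bitsToNat ps / bitsToNat qs ∧ bitsToNat (divR ps qs) = bitsToNat ps % bitsToNat qs := by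
  obtain ⟨h1, h2⟩ := dmL_val qs ps.reverse [] [] (by simpa using hq)
  simp only [bitsToNat_nil, mul_zero, add_zero, zero_mul, zero_add, List.reverse_reverse] at h1
  have key : bitsToNat (dmL qs ps.reverse [] []).1 + bitsToNat qs * bitsToNat (dmL qs ps.reverse [] []).2 = bitsToNat ps ∧
      bitsToNat (dmL qs ps.reverse [] []).1 < bitsToNat qs := ⟨by omega, h2⟩
  have := (Nat.div_mod_unique hq).2 key
  exact ⟨this.1.symm, this.2.symm⟩

/-- The quotient has `|p|` bits. [folklore] -/
@[simp] theorem length_divQ (ps qs : List Bool) : (divQ ps qs).length = ps.length := by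
  simp [divQ, (length_dmL qs ps.reverse [] []).2]

/-- The remainder has `|p|` bits. [folklore] -/
@[simp] theorem length_divR (ps qs : List Bool) : (divR ps qs).length = ps.length := by
  simp [divR, (length_dmL qs ps.reverse [] []).1]

/-- The remainder is below the divisor. [folklore] -/
theorem bitsToNat_divR_lt (ps qs : List Bool) (hq : 0 < bitsToNat qs) : bitsToNat (divR ps qs) < bitsToNat qs :=
  (dmL_val qs ps.reverse [] [] (by simpa using hq)).2

/-- Simulation of the trial-subtraction step. [folklore] -/
theorem runs_dmBranch (x ys z p q r w : List Bool) :
    Runs dmBranch (Sum.elim (AReg.file x ys z [] [] [] [] []) (MOwn.file p q r w))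
      (Sum.elim (AReg.file (bif subBorrow x ys then x else subRes x ys) ys z [] [] [] [] [])
        (MOwn.file p q ((!subBorrow x ys) :: r) w)) (16 * (x.length + ys.length) + 12 + (1 + 2)) := by
  have h1 := (runs_sub x ys z).inl (MOwn.file p q r w)
  refine h1.seq ?_
  cases subBorrow x ys
  · have hp : Runs (push (Sum.inr MOwn.r) true)
        (Sum.elim (AReg.file (subRes x ys) ys z [] [] [] [] []) (MOwn.file p q r w))
        (Sum.elim (AReg.file (subRes x ys) ys z [] [] [] [] []) (MOwn.file p q (true :: r) w)) 1 :=
      Runs.push' (by simp)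
    exact Runs.pop_true' _ _ (w := [])
      (R := Sum.elim (AReg.file (subRes x ys) ys z [] [] [] [] (flag true)) (MOwn.file p q r w))
      rfl (by simp) hp
  · have hp : Runs (push (Sum.inr MOwn.r) false)
        (Sum.elim (AReg.file x ys z [] [] [] [] []) (MOwn.file p q r w))
        (Sum.elim (AReg.file x ys z [] [] [] [] []) (MOwn.file p q (false :: r) w)) 1 :=
      Runs.push' (by simp)
    exact Runs.pop_nil _ _ (R := Sum.elim (AReg.file x ys z [] [] [] [] (flag false)) (MOwn.file p q r w))
      rfl hp

/-- Simulation of the division loop (`|x| + |y| ≤ n` at the start). [folklore] -/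
theorem runs_dmLoop (ys bs x r : List Bool) (n : ℕ) (hn : x.length + ys.length ≤ n)
    (p q w : List Bool) :
    Runs dmLoop (Sum.elim (AReg.file x ys bs [] [] [] [] []) (MOwn.file p q r w))
      (Sum.elim (AReg.file (dmL ys bs x r).1 ys [] [] [] [] [] []) (MOwn.file p q (dmL ys bs x r).2 w))
      (bs.length * (16 * (n + bs.length) + 34) + 1) := by
  induction bs generalizing x r n with
  | nil => exact (Runs.loop_nil _ _ (by rfl)).of_eq (by simp [dmL]) (by simp)
  | cons b bs ih =>
    have hpush : Runs (push (Sum.inl AReg.x) b)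
        (Sum.elim (AReg.file x ys bs [] [] [] [] []) (MOwn.file p q r w))
        (Sum.elim (AReg.file (b :: x) ys bs [] [] [] [] []) (MOwn.file p q r w)) 1 := Runs.push' (by simp)
    have hbr := runs_dmBranch (b :: x) ys bs p q r w
    have hbody := hpush.seq hbr
    have hlen : (bif subBorrow (b :: x) ys then b :: x else subRes (b :: x) ys).length = x.length + 1 := by
      cases subBorrow (b :: x) ys <;> simp [length_subRes]
    have hrest := ih (bif subBorrow (b :: x) ys then b :: x else subRes (b :: x) ys)
      ((!subBorrow (b :: x) ys) :: r) (n + 1) (by omega)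
    cases b
    · refine (Runs.loop_false' (w := bs) ?_ ?_ hbody hrest).of_eq ?_ ?_
      · rfl
      · simp
      · simp [dmL]
      · simp; nlinarith
    · refine (Runs.loop_true' (w := bs) ?_ ?_ hbody hrest).of_eq ?_ ?_
      · rfl
      · simp
      · simp [dmL]
      · simp; nlinarith

/-- **Simulation of `divMod`**: `r := p / q`, `w := p % q` as bit strings `divQ`, `divR`, in at
most `70 (|p| + |q| + 1)²` steps. [Knuth 1998, §4.3.1, Algorithm D] [folklore] -/
theorem runs_divMod (ps qs : List Bool) :
    Runs divMod (Sum.elim (AReg.file [] [] [] [] [] [] [] []) (MOwn.file ps qs [] []))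
      (Sum.elim (AReg.file [] [] [] [] [] [] [] []) (MOwn.file [] qs (divQ ps qs) (divR ps qs)))
      (70 * (ps.length + qs.length + 1) ^ 2) := by
  have h1 : Runs (pour (Sum.inr MOwn.p) (Sum.inl AReg.z))
      (Sum.elim (AReg.file [] [] [] [] [] [] [] []) (MOwn.file ps qs [] []))
      (Sum.elim (AReg.file [] [] ps.reverse [] [] [] [] []) (MOwn.file [] qs [] [])) (3 * ps.length + 1) :=
    (runs_pour (a := (Sum.inr MOwn.p : MReg)) (b := Sum.inl AReg.z) (by decide) _).of_eq
      (by ext i; cases i <;> simp) (by simp)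
  have h2 : Runs (move (Sum.inr MOwn.q) (Sum.inl AReg.y) (Sum.inl AReg.s))
      (Sum.elim (AReg.file [] [] ps.reverse [] [] [] [] []) (MOwn.file [] qs [] []))
      (Sum.elim (AReg.file [] qs ps.reverse [] [] [] [] []) (MOwn.file [] [] [] [])) (6 * qs.length + 2) :=
    (runs_move (a := (Sum.inr MOwn.q : MReg)) (b := Sum.inl AReg.y) (t := Sum.inl AReg.s)
      (by decide) (by decide) (by decide) _ rfl).of_eq (by ext i; cases i <;> simp) (by simp)
  have h3 := runs_dmLoop qs ps.reverse [] [] qs.length (by simp) [] [] []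
  set res := dmL qs ps.reverse [] [] with hres
  have hl := length_dmL qs ps.reverse [] []
  rw [← hres] at hl
  simp only [List.length_nil, zero_add, List.length_reverse] at hl
  have h4 : Runs (move (Sum.inl AReg.x) (Sum.inr MOwn.w) (Sum.inl AReg.s))
      (Sum.elim (AReg.file res.1 qs [] [] [] [] [] []) (MOwn.file [] [] res.2 []))
      (Sum.elim (AReg.file [] qs [] [] [] [] [] []) (MOwn.file [] [] res.2 res.1)) (6 * ps.length + 2) :=
    (runs_move (a := (Sum.inl AReg.x : MReg)) (b := Sum.inr MOwn.w) (t := Sum.inl AReg.s)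
      (by decide) (by decide) (by decide) _ rfl).of_eq (by ext i; cases i <;> simp) (by simp [hl.1])
  have h5 : Runs (move (Sum.inl AReg.y) (Sum.inr MOwn.q) (Sum.inl AReg.s))
      (Sum.elim (AReg.file [] qs [] [] [] [] [] []) (MOwn.file [] [] res.2 res.1))
      (Sum.elim (AReg.file [] [] [] [] [] [] [] []) (MOwn.file [] qs res.2 res.1)) (6 * qs.length + 2) :=
    (runs_move (a := (Sum.inl AReg.y : MReg)) (b := Sum.inr MOwn.q) (t := Sum.inl AReg.s)
      (by decide) (by decide) (by decide) _ rfl).of_eq (by ext i; cases i <;> simp) (by simp)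
  refine (h1.seq (h2.seq (h3.seq (h4.seq h5)))).of_eq (by simp [divQ, divR, hres]) ?_
  simp only [List.length_reverse]
  nlinarith

end Com

/-! ### The registers of the exponentiation layer -/

/-- The four registers of the modular-exponentiation layer: base `b`, exponent `e`,
accumulator `a`, modulus `m`. [folklore] -/
inductive EOwn where
  | b | e | a | m
  deriving DecidableEq, Fintype, Repr

namespace EOwn

/-- A register file of the layer given register by register. [folklore] -/
def file (b e a m : List Bool) : Regs EOwn
  | .b => b | .e => e | .a => a | .m => m

section FileLemmas
variable (b e a m v : List Bool)
/-- Reading `b`. [folklore] -/ @[simp] theorem file_b : file b e a m .b = b := rfl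
/-- Reading `e`. [folklore] -/ @[simp] theorem file_e : file b e a m .e = e := rfl
/-- Reading `a`. [folklore] -/ @[simp] theorem file_a : file b e a m .a = a := rfl
/-- Reading `m`. [folklore] -/ @[simp] theorem file_m : file b e a m .m = m := rfl
/-- Writing `b`. [folklore] -/
@[simp] theorem update_file_b : Function.update (file b e a m) .b v = file v e a m := by
  funext i; cases i <;> rfl
/-- Writing `e`. [folklore] -/
@[simp] theorem update_file_e : Function.update (file b e a m) .e v = file b v a m := by
  funext i; cases i <;> rfl
/-- Writing `a`. [folklore] -/
@[simp] theorem update_file_a : Function.update (file b e a m) .a v = file b e v m := by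
  funext i; cases i <;> rfl
/-- Writing `m`. [folklore] -/
@[simp] theorem update_file_m : Function.update (file b e a m) .m v = file b e a v := by
  funext i; cases i <;> rfl
end FileLemmas

end EOwn

/-- Registers of the exponentiation layer. [folklore] -/
abbrev EReg : Type := MReg ⊕ EOwn

/-- The clean state of the two lower banks. [folklore] -/
abbrev lowClean : Regs MReg := Sum.elim (AReg.file [] [] [] [] [] [] [] []) (MOwn.file [] [] [] [])

namespace Com

/-! ### Modular multiplication and exponentiation on the fixed bank

(See the module docstring for the relation to `StackModArith.modMul`/`modExp`.) -/

/-- `mulMod dst src`: `dst := dst · src mod m`, normalised (`src`, `m` preserved; lower banks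
clean before and after). [Knuth 1998, §4.3.1 with §4.6.3] [folklore] -/
def mulMod (dst src : EOwn) : Com EReg :=
  copy (.inr src) (.inl (.inr .q)) (.inl (.inl .t)) (.inl (.inl .u)) ;;
  move (.inr dst) (.inl (.inr .p)) (.inl (.inl .s)) ;;
  mul.map Sum.inl ;;
  move (.inl (.inr .r)) (.inl (.inr .p)) (.inl (.inl .s)) ;;
  copy (.inr .m) (.inl (.inr .q)) (.inl (.inl .t)) (.inl (.inl .u)) ;;
  divMod.map Sum.inl ;;
  clear (.inl (.inr .r)) ;; clear (.inl (.inr .q)) ;;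
  move (.inl (.inr .w)) (.inl (.inl .x)) (.inl (.inl .s)) ;;
  (normalize.map Sum.inl).map Sum.inl ;;
  move (.inl (.inl .x)) (.inr dst) (.inl (.inl .s))

/-- The result of a modular multiplication as a bit string: the numeral of the residue.
[folklore] -/
theorem norm_divR_mulRes (u v ms : List Bool) (hm : 0 < bitsToNat ms) :
    norm (divR (mulRes u v) ms) = encodeNat (bitsToNat u * bitsToNat v % bitsToNat ms) := by
  rw [norm_eq_encodeNat, (bitsToNat_divMod _ _ hm).2, bitsToNat_mulRes]

/-- A residue modulo `m` has at most `|m|` bits in normal form (from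
`StackModArith.length_norm_le_of_lt`). [folklore] -/
theorem length_encodeNat_mod_le (n : ℕ) (ms : List Bool) (hm : 0 < bitsToNat ms) :
    (encodeNat (n % bitsToNat ms)).length ≤ ms.length := by
  rw [← norm_encodeNat]
  exact length_norm_le_of_lt (by rw [bitsToNat_encodeNat]; exact Nat.mod_lt _ hm)

/-- **Simulation of `mulMod a b`** (accumulator times base). [Knuth 1998, §4.6.3] [folklore] -/
theorem runs_mulMod_ab (bs es as ms : List Bool) (n : ℕ) (hb : bs.length ≤ n) (ha : as.length ≤ n)
    (hmn : ms.length ≤ n) (hm : 0 < bitsToNat ms) :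
    Runs (mulMod .a .b) (Sum.elim lowClean (EOwn.file bs es as ms))
      (Sum.elim lowClean (EOwn.file bs es (encodeNat (bitsToNat as * bitsToNat bs % bitsToNat ms)) ms))
      (900 * (n + 1) ^ 2) := by
  -- the eleven stages, with their intermediate states
  have h1 : Runs (copy (Sum.inr EOwn.b) (Sum.inl (Sum.inr MOwn.q)) (Sum.inl (Sum.inl AReg.t)) (Sum.inl (Sum.inl AReg.u)))
      (Sum.elim lowClean (EOwn.file bs es as ms))
      (Sum.elim (Sum.elim (AReg.file [] [] [] [] [] [] [] []) (MOwn.file [] bs [] [])) (EOwn.file bs es as ms))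
      (10 * bs.length + 3) :=
    (runs_copy (a := (Sum.inr EOwn.b : EReg)) (b := Sum.inl (Sum.inr MOwn.q)) (t := Sum.inl (Sum.inl AReg.t))
      (u := Sum.inl (Sum.inl AReg.u)) (by decide) (by decide) (by decide) (by decide) (by decide) (by decide)
      _ rfl rfl).of_eq (by ext i; rcases i with ((i|i)|i) <;> cases i <;> simp [lowClean]) (by simp)
  have h2 : Runs (move (Sum.inr EOwn.a) (Sum.inl (Sum.inr MOwn.p)) (Sum.inl (Sum.inl AReg.s)))
      (Sum.elim (Sum.elim (AReg.file [] [] [] [] [] [] [] []) (MOwn.file [] bs [] [])) (EOwn.file bs es as ms))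
      (Sum.elim (Sum.elim (AReg.file [] [] [] [] [] [] [] []) (MOwn.file as bs [] [])) (EOwn.file bs es [] ms))
      (6 * as.length + 2) :=
    (runs_move (a := (Sum.inr EOwn.a : EReg)) (b := Sum.inl (Sum.inr MOwn.p)) (t := Sum.inl (Sum.inl AReg.s))
      (by decide) (by decide) (by decide) _ rfl).of_eq (by ext i; rcases i with ((i|i)|i) <;> cases i <;> simp) (by simp)
  have h3 : Runs (mul.map Sum.inl)
      (Sum.elim (Sum.elim (AReg.file [] [] [] [] [] [] [] []) (MOwn.file as bs [] [])) (EOwn.file bs es [] ms))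
      (Sum.elim (Sum.elim (AReg.file [] [] [] [] [] [] [] []) (MOwn.file [] [] (mulRes as bs) [])) (EOwn.file bs es [] ms))
      (50 * (as.length + bs.length + 1) ^ 2) := (runs_mul as bs [] [] [] []).inl _
  set pr := mulRes as bs with hpr
  have hprl : pr.length ≤ 2 * n + 1 := by have := length_mulRes_le as bs; rw [← hpr] at this; omega
  have h4 : Runs (move (Sum.inl (Sum.inr MOwn.r)) (Sum.inl (Sum.inr MOwn.p)) (Sum.inl (Sum.inl AReg.s)))
      (Sum.elim (Sum.elim (AReg.file [] [] [] [] [] [] [] []) (MOwn.file [] [] pr [])) (EOwn.file bs es [] ms))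
      (Sum.elim (Sum.elim (AReg.file [] [] [] [] [] [] [] []) (MOwn.file pr [] [] [])) (EOwn.file bs es [] ms))
      (6 * pr.length + 2) :=
    (runs_move (a := (Sum.inl (Sum.inr MOwn.r) : EReg)) (b := Sum.inl (Sum.inr MOwn.p)) (t := Sum.inl (Sum.inl AReg.s))
      (by decide) (by decide) (by decide) _ rfl).of_eq (by ext i; rcases i with ((i|i)|i) <;> cases i <;> simp) (by simp)
  have h5 : Runs (copy (Sum.inr EOwn.m) (Sum.inl (Sum.inr MOwn.q)) (Sum.inl (Sum.inl AReg.t)) (Sum.inl (Sum.inl AReg.u)))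
      (Sum.elim (Sum.elim (AReg.file [] [] [] [] [] [] [] []) (MOwn.file pr [] [] [])) (EOwn.file bs es [] ms))
      (Sum.elim (Sum.elim (AReg.file [] [] [] [] [] [] [] []) (MOwn.file pr ms [] [])) (EOwn.file bs es [] ms))
      (10 * ms.length + 3) :=
    (runs_copy (a := (Sum.inr EOwn.m : EReg)) (b := Sum.inl (Sum.inr MOwn.q)) (t := Sum.inl (Sum.inl AReg.t))
      (u := Sum.inl (Sum.inl AReg.u)) (by decide) (by decide) (by decide) (by decide) (by decide) (by decide)
      _ rfl rfl).of_eq (by ext i; rcases i with ((i|i)|i) <;> cases i <;> simp) (by simp)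
  have h6 : Runs (divMod.map Sum.inl)
      (Sum.elim (Sum.elim (AReg.file [] [] [] [] [] [] [] []) (MOwn.file pr ms [] [])) (EOwn.file bs es [] ms))
      (Sum.elim (Sum.elim (AReg.file [] [] [] [] [] [] [] []) (MOwn.file [] ms (divQ pr ms) (divR pr ms))) (EOwn.file bs es [] ms))
      (70 * (pr.length + ms.length + 1) ^ 2) := (runs_divMod pr ms).inl _
  have h7 : Runs (clear (Sum.inl (Sum.inr MOwn.r)))
      (Sum.elim (Sum.elim (AReg.file [] [] [] [] [] [] [] []) (MOwn.file [] ms (divQ pr ms) (divR pr ms))) (EOwn.file bs es [] ms))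
      (Sum.elim (Sum.elim (AReg.file [] [] [] [] [] [] [] []) (MOwn.file [] ms [] (divR pr ms))) (EOwn.file bs es [] ms))
      (2 * pr.length + 1) :=
    (runs_clear (Sum.inl (Sum.inr MOwn.r) : EReg) _).of_eq (by ext i; rcases i with ((i|i)|i) <;> cases i <;> simp) (by simp)
  have h8 : Runs (clear (Sum.inl (Sum.inr MOwn.q)))
      (Sum.elim (Sum.elim (AReg.file [] [] [] [] [] [] [] []) (MOwn.file [] ms [] (divR pr ms))) (EOwn.file bs es [] ms))
      (Sum.elim (Sum.elim (AReg.file [] [] [] [] [] [] [] []) (MOwn.file [] [] [] (divR pr ms))) (EOwn.file bs es [] ms))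
      (2 * ms.length + 1) :=
    (runs_clear (Sum.inl (Sum.inr MOwn.q) : EReg) _).of_eq (by ext i; rcases i with ((i|i)|i) <;> cases i <;> simp) (by simp)
  have h9 : Runs (move (Sum.inl (Sum.inr MOwn.w)) (Sum.inl (Sum.inl AReg.x)) (Sum.inl (Sum.inl AReg.s)))
      (Sum.elim (Sum.elim (AReg.file [] [] [] [] [] [] [] []) (MOwn.file [] [] [] (divR pr ms))) (EOwn.file bs es [] ms))
      (Sum.elim (Sum.elim (AReg.file (divR pr ms) [] [] [] [] [] [] []) (MOwn.file [] [] [] [])) (EOwn.file bs es [] ms))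
      (6 * pr.length + 2) :=
    (runs_move (a := (Sum.inl (Sum.inr MOwn.w) : EReg)) (b := Sum.inl (Sum.inl AReg.x)) (t := Sum.inl (Sum.inl AReg.s))
      (by decide) (by decide) (by decide) _ rfl).of_eq (by ext i; rcases i with ((i|i)|i) <;> cases i <;> simp) (by simp)
  have h10 : Runs ((normalize.map Sum.inl).map Sum.inl)
      (Sum.elim (Sum.elim (AReg.file (divR pr ms) [] [] [] [] [] [] []) (MOwn.file [] [] [] [])) (EOwn.file bs es [] ms))
      (Sum.elim (Sum.elim (AReg.file (norm (divR pr ms)) [] [] [] [] [] [] []) (MOwn.file [] [] [] [])) (EOwn.file bs es [] ms))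
      (9 * pr.length + 5) := ((runs_normalize (divR pr ms) [] [] [] [] []).inl _).inl _ |>.of_eq rfl (by simp)
  set res := norm (divR pr ms) with hres
  have hresl : res.length ≤ n := by
    rw [hres, hpr, norm_divR_mulRes _ _ _ hm]; exact (length_encodeNat_mod_le _ _ hm).trans hmn
  have h11 : Runs (move (Sum.inl (Sum.inl AReg.x)) (Sum.inr EOwn.a) (Sum.inl (Sum.inl AReg.s)))
      (Sum.elim (Sum.elim (AReg.file res [] [] [] [] [] [] []) (MOwn.file [] [] [] [])) (EOwn.file bs es [] ms))
      (Sum.elim lowClean (EOwn.file bs es res ms)) (6 * res.length + 2) :=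
    (runs_move (a := (Sum.inl (Sum.inl AReg.x) : EReg)) (b := Sum.inr EOwn.a) (t := Sum.inl (Sum.inl AReg.s))
      (by decide) (by decide) (by decide) _ rfl).of_eq (by ext i; rcases i with ((i|i)|i) <;> cases i <;> simp [lowClean]) (by simp)
  refine (h1.seq (h2.seq (h3.seq (h4.seq (h5.seq (h6.seq (h7.seq (h8.seq (h9.seq (h10.seq h11)))))))))).of_eq ?_ ?_
  · rw [hres, hpr, norm_divR_mulRes _ _ _ hm]
  · nlinarith [hprl, hresl, hb, ha, hmn]

/-- **Simulation of `mulMod b b`** (squaring the base). [Knuth 1998, §4.6.3] [folklore] -/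
theorem runs_mulMod_bb (bs es as ms : List Bool) (n : ℕ) (hb : bs.length ≤ n)
    (hmn : ms.length ≤ n) (hm : 0 < bitsToNat ms) :
    Runs (mulMod .b .b) (Sum.elim lowClean (EOwn.file bs es as ms))
      (Sum.elim lowClean (EOwn.file (encodeNat (bitsToNat bs * bitsToNat bs % bitsToNat ms)) es as ms))
      (900 * (n + 1) ^ 2) := by
  -- the eleven stages, with their intermediate states
  have h1 : Runs (copy (Sum.inr EOwn.b) (Sum.inl (Sum.inr MOwn.q)) (Sum.inl (Sum.inl AReg.t)) (Sum.inl (Sum.inl AReg.u)))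
      (Sum.elim lowClean (EOwn.file bs es as ms))
      (Sum.elim (Sum.elim (AReg.file [] [] [] [] [] [] [] []) (MOwn.file [] bs [] [])) (EOwn.file bs es as ms))
      (10 * bs.length + 3) :=
    (runs_copy (a := (Sum.inr EOwn.b : EReg)) (b := Sum.inl (Sum.inr MOwn.q)) (t := Sum.inl (Sum.inl AReg.t))
      (u := Sum.inl (Sum.inl AReg.u)) (by decide) (by decide) (by decide) (by decide) (by decide) (by decide)
      _ rfl rfl).of_eq (by ext i; rcases i with ((i|i)|i) <;> cases i <;> simp [lowClean]) (by simp)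
  have h2 : Runs (move (Sum.inr EOwn.b) (Sum.inl (Sum.inr MOwn.p)) (Sum.inl (Sum.inl AReg.s)))
      (Sum.elim (Sum.elim (AReg.file [] [] [] [] [] [] [] []) (MOwn.file [] bs [] [])) (EOwn.file bs es as ms))
      (Sum.elim (Sum.elim (AReg.file [] [] [] [] [] [] [] []) (MOwn.file bs bs [] [])) (EOwn.file [] es as ms))
      (6 * bs.length + 2) :=
    (runs_move (a := (Sum.inr EOwn.b : EReg)) (b := Sum.inl (Sum.inr MOwn.p)) (t := Sum.inl (Sum.inl AReg.s))
      (by decide) (by decide) (by decide) _ rfl).of_eq (by ext i; rcases i with ((i|i)|i) <;> cases i <;> simp) (by simp)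
  have h3 : Runs (mul.map Sum.inl)
      (Sum.elim (Sum.elim (AReg.file [] [] [] [] [] [] [] []) (MOwn.file bs bs [] [])) (EOwn.file [] es as ms))
      (Sum.elim (Sum.elim (AReg.file [] [] [] [] [] [] [] []) (MOwn.file [] [] (mulRes bs bs) [])) (EOwn.file [] es as ms))
      (50 * (bs.length + bs.length + 1) ^ 2) := (runs_mul bs bs [] [] [] []).inl _
  set pr := mulRes bs bs with hpr
  have hprl : pr.length ≤ 2 * n + 1 := by have := length_mulRes_le bs bs; rw [← hpr] at this; omega
  have h4 : Runs (move (Sum.inl (Sum.inr MOwn.r)) (Sum.inl (Sum.inr MOwn.p)) (Sum.inl (Sum.inl AReg.s)))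
      (Sum.elim (Sum.elim (AReg.file [] [] [] [] [] [] [] []) (MOwn.file [] [] pr [])) (EOwn.file [] es as ms))
      (Sum.elim (Sum.elim (AReg.file [] [] [] [] [] [] [] []) (MOwn.file pr [] [] [])) (EOwn.file [] es as ms))
      (6 * pr.length + 2) :=
    (runs_move (a := (Sum.inl (Sum.inr MOwn.r) : EReg)) (b := Sum.inl (Sum.inr MOwn.p)) (t := Sum.inl (Sum.inl AReg.s))
      (by decide) (by decide) (by decide) _ rfl).of_eq (by ext i; rcases i with ((i|i)|i) <;> cases i <;> simp) (by simp)
  have h5 : Runs (copy (Sum.inr EOwn.m) (Sum.inl (Sum.inr MOwn.q)) (Sum.inl (Sum.inl AReg.t)) (Sum.inl (Sum.inl AReg.u)))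
      (Sum.elim (Sum.elim (AReg.file [] [] [] [] [] [] [] []) (MOwn.file pr [] [] [])) (EOwn.file [] es as ms))
      (Sum.elim (Sum.elim (AReg.file [] [] [] [] [] [] [] []) (MOwn.file pr ms [] [])) (EOwn.file [] es as ms))
      (10 * ms.length + 3) :=
    (runs_copy (a := (Sum.inr EOwn.m : EReg)) (b := Sum.inl (Sum.inr MOwn.q)) (t := Sum.inl (Sum.inl AReg.t))
      (u := Sum.inl (Sum.inl AReg.u)) (by decide) (by decide) (by decide) (by decide) (by decide) (by decide)
      _ rfl rfl).of_eq (by ext i; rcases i with ((i|i)|i) <;> cases i <;> simp) (by simp)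
  have h6 : Runs (divMod.map Sum.inl)
      (Sum.elim (Sum.elim (AReg.file [] [] [] [] [] [] [] []) (MOwn.file pr ms [] [])) (EOwn.file [] es as ms))
      (Sum.elim (Sum.elim (AReg.file [] [] [] [] [] [] [] []) (MOwn.file [] ms (divQ pr ms) (divR pr ms))) (EOwn.file [] es as ms))
      (70 * (pr.length + ms.length + 1) ^ 2) := (runs_divMod pr ms).inl _
  have h7 : Runs (clear (Sum.inl (Sum.inr MOwn.r)))
      (Sum.elim (Sum.elim (AReg.file [] [] [] [] [] [] [] []) (MOwn.file [] ms (divQ pr ms) (divR pr ms))) (EOwn.file [] es as ms))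
      (Sum.elim (Sum.elim (AReg.file [] [] [] [] [] [] [] []) (MOwn.file [] ms [] (divR pr ms))) (EOwn.file [] es as ms))
      (2 * pr.length + 1) :=
    (runs_clear (Sum.inl (Sum.inr MOwn.r) : EReg) _).of_eq (by ext i; rcases i with ((i|i)|i) <;> cases i <;> simp) (by simp)
  have h8 : Runs (clear (Sum.inl (Sum.inr MOwn.q)))
      (Sum.elim (Sum.elim (AReg.file [] [] [] [] [] [] [] []) (MOwn.file [] ms [] (divR pr ms))) (EOwn.file [] es as ms))
      (Sum.elim (Sum.elim (AReg.file [] [] [] [] [] [] [] []) (MOwn.file [] [] [] (divR pr ms))) (EOwn.file [] es as ms))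
      (2 * ms.length + 1) :=
    (runs_clear (Sum.inl (Sum.inr MOwn.q) : EReg) _).of_eq (by ext i; rcases i with ((i|i)|i) <;> cases i <;> simp) (by simp)
  have h9 : Runs (move (Sum.inl (Sum.inr MOwn.w)) (Sum.inl (Sum.inl AReg.x)) (Sum.inl (Sum.inl AReg.s)))
      (Sum.elim (Sum.elim (AReg.file [] [] [] [] [] [] [] []) (MOwn.file [] [] [] (divR pr ms))) (EOwn.file [] es as ms))
      (Sum.elim (Sum.elim (AReg.file (divR pr ms) [] [] [] [] [] [] []) (MOwn.file [] [] [] [])) (EOwn.file [] es as ms))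
      (6 * pr.length + 2) :=
    (runs_move (a := (Sum.inl (Sum.inr MOwn.w) : EReg)) (b := Sum.inl (Sum.inl AReg.x)) (t := Sum.inl (Sum.inl AReg.s))
      (by decide) (by decide) (by decide) _ rfl).of_eq (by ext i; rcases i with ((i|i)|i) <;> cases i <;> simp) (by simp)
  have h10 : Runs ((normalize.map Sum.inl).map Sum.inl)
      (Sum.elim (Sum.elim (AReg.file (divR pr ms) [] [] [] [] [] [] []) (MOwn.file [] [] [] [])) (EOwn.file [] es as ms))
      (Sum.elim (Sum.elim (AReg.file (norm (divR pr ms)) [] [] [] [] [] [] []) (MOwn.file [] [] [] [])) (EOwn.file [] es as ms))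
      (9 * pr.length + 5) := ((runs_normalize (divR pr ms) [] [] [] [] []).inl _).inl _ |>.of_eq rfl (by simp)
  set res := norm (divR pr ms) with hres
  have hresl : res.length ≤ n := by
    rw [hres, hpr, norm_divR_mulRes _ _ _ hm]; exact (length_encodeNat_mod_le _ _ hm).trans hmn
  have h11 : Runs (move (Sum.inl (Sum.inl AReg.x)) (Sum.inr EOwn.b) (Sum.inl (Sum.inl AReg.s)))
      (Sum.elim (Sum.elim (AReg.file res [] [] [] [] [] [] []) (MOwn.file [] [] [] [])) (EOwn.file [] es as ms))
      (Sum.elim lowClean (EOwn.file res es as ms)) (6 * res.length + 2) :=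
    (runs_move (a := (Sum.inl (Sum.inl AReg.x) : EReg)) (b := Sum.inr EOwn.b) (t := Sum.inl (Sum.inl AReg.s))
      (by decide) (by decide) (by decide) _ rfl).of_eq (by ext i; rcases i with ((i|i)|i) <;> cases i <;> simp [lowClean]) (by simp)
  refine (h1.seq (h2.seq (h3.seq (h4.seq (h5.seq (h6.seq (h7.seq (h8.seq (h9.seq (h10.seq h11)))))))))).of_eq ?_ ?_
  · rw [hres, hpr, norm_divR_mulRes _ _ _ hm]
  · nlinarith [hprl, hresl, hb, hmn]

/-- The exponentiation loop: square and multiply over the bits of `e`. [Knuth 1998, §4.6.3,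
Algorithm A (right-to-left binary method)] [folklore] -/
def powLoop : Com EReg := loop (.inr .e) (mulMod .a .b ;; mulMod .b .b) (mulMod .b .b)

/-- **Modular exponentiation** `a := b ^ e mod m` (`a` must be empty, `e` is consumed, `b` is
replaced by a power of itself; lower banks clean). [Knuth 1998, §4.6.3, Algorithm A] [folklore] -/
def powMod : Com EReg := push (.inr .a) true ;; powLoop

/-- Model of the exponentiation loop on bit strings. [folklore] -/
def peL (M : ℕ) : List Bool → List Bool → List Bool → List Bool × List Bool
  | [], as, bs => (as, bs)
  | c :: es, as, bs =>
    peL M es (bif c then encodeNat (bitsToNat as * bitsToNat bs % M) else as) (encodeNat (bitsToNat bs * bitsToNat bs % M))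

/-- **Invariant of square-and-multiply**: value, canonicity and range of the accumulator.
[Knuth 1998, §4.6.3] [folklore] -/
theorem peL_spec (M : ℕ) (hM : 1 < M) (es as bs : List Bool) (has : as = encodeNat (bitsToNat as))
    (hlt : bitsToNat as < M) :
    (peL M es as bs).1 = encodeNat (bitsToNat as * bitsToNat bs ^ bitsToNat es % M) := by
  induction es generalizing as bs with
  | nil => simp [peL, Nat.mod_eq_of_lt hlt, ← has]
  | cons c es ih =>
    rw [peL]
    have hM0 : 0 < M := by omega
    cases c
    · simp only [cond_false]
      rw [ih as _ has hlt]
      simp only [bitsToNat_encodeNat, bitsToNat_cons, Bool.toNat_false, zero_add]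
      congr 1
      have h : bitsToNat as * (bitsToNat bs * bitsToNat bs % M) ^ bitsToNat es ≡ bitsToNat as * bitsToNat bs ^ (2 * bitsToNat es) [MOD M] := by
        have := ((Nat.mod_modEq (bitsToNat bs * bitsToNat bs) M).pow (bitsToNat es)).mul_left (bitsToNat as)
        have e : (bitsToNat bs * bitsToNat bs) ^ bitsToNat es = bitsToNat bs ^ (2 * bitsToNat es) := by rw [← pow_two, ← pow_mul]
        rwa [e] at this
      exact h
    · simp only [cond_true]
      rw [ih _ _ (by simp) (by simpa using Nat.mod_lt _ hM0)]
      simp only [bitsToNat_encodeNat, bitsToNat_cons, Bool.toNat_true]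
      congr 1
      have h : bitsToNat as * bitsToNat bs % M * (bitsToNat bs * bitsToNat bs % M) ^ bitsToNat es ≡
          bitsToNat as * bitsToNat bs ^ (1 + 2 * bitsToNat es) [MOD M] := by
        have := (Nat.mod_modEq (bitsToNat as * bitsToNat bs) M).mul ((Nat.mod_modEq (bitsToNat bs * bitsToNat bs) M).pow (bitsToNat es))
        have e : bitsToNat as * bitsToNat bs * (bitsToNat bs * bitsToNat bs) ^ bitsToNat es = bitsToNat as * bitsToNat bs ^ (1 + 2 * bitsToNat es) := by
          rw [← pow_two, ← pow_mul, pow_add, pow_one]; ring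
        rwa [e] at this
      exact h

/-- Both registers stay short in the exponentiation loop. [folklore] -/
theorem length_peL_le (ms : List Bool) (hm : 0 < bitsToNat ms) (es as bs : List Bool) (n : ℕ)
    (has : as.length ≤ n) (hbs : bs.length ≤ n) (hmn : ms.length ≤ n) :
    (peL (bitsToNat ms) es as bs).1.length ≤ n ∧ (peL (bitsToNat ms) es as bs).2.length ≤ n := by
  induction es generalizing as bs with
  | nil => exact ⟨has, hbs⟩
  | cons c es ih =>
    rw [peL]
    refine ih _ _ ?_ ((length_encodeNat_mod_le _ _ hm).trans hmn)
    cases c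
    · exact has
    · exact (length_encodeNat_mod_le _ _ hm).trans hmn

/-- Simulation of the exponentiation loop. [folklore] -/
theorem runs_powLoop (ms : List Bool) (hm : 0 < bitsToNat ms) (n : ℕ) (hmn : ms.length ≤ n)
    (es as bs : List Bool) (has : as.length ≤ n) (hbs : bs.length ≤ n) :
    Runs powLoop (Sum.elim lowClean (EOwn.file bs es as ms))
      (Sum.elim lowClean (EOwn.file (peL (bitsToNat ms) es as bs).2 [] (peL (bitsToNat ms) es as bs).1 ms))
      (es.length * (1800 * (n + 1) ^ 2 + 2) + 1) := by
  induction es generalizing as bs with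
  | nil => exact (Runs.loop_nil _ _ (by rfl)).of_eq (by simp [peL]) (by simp)
  | cons c es ih =>
    have hsq : ∀ as' : List Bool, Runs (mulMod .b .b) (Sum.elim lowClean (EOwn.file bs es as' ms))
        (Sum.elim lowClean (EOwn.file (encodeNat (bitsToNat bs * bitsToNat bs % bitsToNat ms)) es as' ms)) (900 * (n + 1) ^ 2) :=
      fun as' => runs_mulMod_bb bs es as' ms n hbs hmn hm
    have hl : (encodeNat (bitsToNat bs * bitsToNat bs % bitsToNat ms)).length ≤ n := (length_encodeNat_mod_le _ _ hm).trans hmn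
    cases c
    · have hrest := ih as (encodeNat (bitsToNat bs * bitsToNat bs % bitsToNat ms)) has hl
      refine (Runs.loop_false' (w := es) ?_ ?_ (hsq as) hrest).of_eq ?_ ?_
      · rfl
      · simp
      · simp [peL]
      · simp; nlinarith
    · have hmul := runs_mulMod_ab bs es as ms n hbs has hmn hm
      have hl' : (encodeNat (bitsToNat as * bitsToNat bs % bitsToNat ms)).length ≤ n := (length_encodeNat_mod_le _ _ hm).trans hmn
      have hbody := hmul.seq (hsq (encodeNat (bitsToNat as * bitsToNat bs % bitsToNat ms)))
      have hrest := ih (encodeNat (bitsToNat as * bitsToNat bs % bitsToNat ms)) (encodeNat (bitsToNat bs * bitsToNat bs % bitsToNat ms)) hl' hl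
      refine (Runs.loop_true' (w := es) ?_ ?_ hbody hrest).of_eq ?_ ?_
      · rfl
      · simp
      · simp [peL]
      · simp; nlinarith

/-- **Simulation of `powMod`**: `a := numeral of b ^ e mod m`, for `1 < m`, in
`|e| (1800 (n+1)² + 2) + 2` steps when `|b|, |m| ≤ n` (`n ≥ 1`).
[Knuth 1998, §4.6.3, Algorithm A] [folklore] -/
theorem runs_powMod (ms : List Bool) (hm : 1 < bitsToNat ms) (n : ℕ) (hn : 1 ≤ n) (hmn : ms.length ≤ n)
    (es bs : List Bool) (hbs : bs.length ≤ n) :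
    Runs powMod (Sum.elim lowClean (EOwn.file bs es [] ms))
      (Sum.elim lowClean (EOwn.file (peL (bitsToNat ms) es [true] bs).2 []
        (encodeNat (bitsToNat bs ^ bitsToNat es % bitsToNat ms)) ms))
      (es.length * (1800 * (n + 1) ^ 2 + 2) + 2) := by
  have h1 : Runs (push (Sum.inr EOwn.a) true) (Sum.elim lowClean (EOwn.file bs es [] ms))
      (Sum.elim lowClean (EOwn.file bs es [true] ms)) 1 := Runs.push' (by simp)
  have h2 := runs_powLoop ms (by omega) n hmn es [true] bs (by simp; omega) hbs
  have hval := peL_spec (bitsToNat ms) hm es [true] bs (by decide) (by simp; omega)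
  refine (h1.seq h2).of_eq ?_ (by omega)
  rw [hval]; simp

end Com

end Literature.Computability.Complexity
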